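import Literature.RingTheory.SymmetricFunctions.SchurPolynomials
import HarnessLib

/-!
# The Schur polynomial of a column is the elementary symmetric polynomial: `s_{(1^r)} = e_r`

Topic `RingTheory/SymmetricFunctions`; namespace `Literature.RingTheory.SymmetricFunctions.SymmPoly`
(sequel to `SchurPolynomials`). Everything here is **proved** (Mathlib + `SchurPolynomials`);
theorems only, no definition, no named fact.

* `alternant_eq_sum_column` — **Laplace expansion of an alternant along an arbitrary exponent**
  `j`: `a_μ(x) = ∑_i (-1)^{i+j} x_i^{μ_j} a_{μ ∘ j.succAbove}(x^{(i)})` for `x ∈ Rⁿ⁺¹`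
  (`Matrix.det_succ_column`; the companion file `LittlewoodIdentity` uses the last column only);
  `alternant_add_const` — `a_{μ + c}(x) = (∏ x_i)^c a_μ(x)`.
* `esymm_mul_alternant_rho` — in the dual Pieri rule `e_r(x) a_ρ(x) = ∑_{#S = r} a_{ρ + 1_S}(x)`
  (`esymm_mul_alternant`) only the initial vertical strip `S = [0, r)` survives:
  `e_r(x) a_ρ(x) = a_{(1^r) + ρ}(x)` (`r ≤ n`), because `ρ + 1_S` repeats an exponent as soon as
  `m ∉ S ∋ m + 1` (`alternant_addOn_rho_eq_zero_of_ne`, `exists_adjacent_not_mem_mem`).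
* `schur_column_eq_esymm` — **`s_{(1^r)}(x_1, …, x_n) = e_r(x_1, …, x_n)`** for `r ≤ n` and `x` in
  any commutative ring, the column case of the Jacobi–Trudi/Nägelsbach–Kostka duality
  (Macdonald 1995, Ch. I §3, (3.9) with (2.?) : `s_{(1^r)} = e_r`), proved by cancelling
  `a_ρ(X) ≠ 0` at the generic point `ℤ[X_1, …, X_n]` and specialising (as `esymm_mul_schur`).
  With the tree's Jacobi–Trudi *definition* `schur x λ = det (h_{λ_i - i + j})` this is the
  determinant identity `det (h_{1 - i + j})_{r × r} = e_r` (Macdonald Ch. I (2.6')), obtained here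
  without determinant manipulation.

## References

* I. G. Macdonald, *Symmetric Functions and Hall Polynomials*, 2nd ed., Oxford (1995), Ch. I,
  §2 (2.6'), §3 (3.4), (3.5), (3.9), §5 (5.17) (Pieri's formula for `e_r`) [Macdonald1995].
-/

noncomputable section

open Matrix Finset PowerSeries Equiv

namespace Literature.RingTheory.SymmetricFunctions.SymmPoly

variable {R : Type*} [CommRing R] {n : ℕ}

/-! ### Laplace expansion and exponent shifts of alternants -/

/-- **Laplace expansion of an alternant along an arbitrary exponent** `j`:
`a_μ(x) = ∑_i (-1)^{i+j} x_i^{μ_j} a_{μ ∘ j.succAbove}(x^{(i)})`, where `x^{(i)} = x ∘ i.succAbove`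
is `x` with the `i`-th variable removed (`Matrix.det_succ_column`). [folklore] -/
theorem alternant_eq_sum_column (x : Fin (n + 1) → R) (μ : Fin (n + 1) → ℕ) (j : Fin (n + 1)) :
    alternant x μ = ∑ i : Fin (n + 1), (-1) ^ ((i : ℕ) + j) * x i ^ μ j *
      alternant (x ∘ i.succAbove) (μ ∘ j.succAbove) := by
  rw [alternant, Matrix.det_succ_column _ j]
  refine Finset.sum_congr rfl fun i _ => ?_
  simp only [Matrix.of_apply]
  congr 1

/-- Shifting all exponents by `c` multiplies the alternant by `(∏_i x_i)^c`:
`a_{μ + c}(x) = (x_1 ⋯ x_n)^c a_μ(x)`. [folklore] -/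
theorem alternant_add_const (x : Fin n → R) (μ : Fin n → ℕ) (c : ℕ) :
    alternant x (fun j => μ j + c) = (∏ i, x i) ^ c * alternant x μ := by
  have : (Matrix.of fun i j : Fin n => x i ^ (μ j + c)) =
      Matrix.of fun i j : Fin n =>
        (fun i => x i ^ c) i * (Matrix.of fun i j : Fin n => x i ^ μ j) i j := by
    ext i j
    simp only [Matrix.of_apply, pow_add, mul_comm]
  rw [alternant, this, Matrix.det_mul_column, Finset.prod_pow]
  rfl

/-! ### Only the initial vertical strip survives on the staircase -/

/-- Two adjacent exponents of `ρ + 1_S` coincide when `m ∉ S ∋ m + 1`, so the alternant vanishes.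
[folklore] -/
theorem alternant_addOn_rho_eq_zero (x : Fin n → R) {S : Finset (Fin n)} {m : Fin n}
    (hm : (m : ℕ) + 1 < n) (h1 : m ∉ S) (h2 : (⟨(m : ℕ) + 1, hm⟩ : Fin n) ∈ S) :
    alternant x (addOn S (rho n)) = 0 := by
  refine alternant_eq_zero_of_apply_eq x (i := m) (j := ⟨(m : ℕ) + 1, hm⟩) ?_ ?_
  · intro h
    have := congrArg Fin.val h
    simp at this
  · simp only [addOn_apply, rho_apply, if_neg h1, if_pos h2]
    omega

/-- If `a < b`, `a ∉ S`, `b ∈ S` (`b = a + d + 1`), then some `m ∉ S` has `m + 1 ∈ S`.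
[folklore] -/
theorem exists_adjacent_not_mem_mem (S : Finset (Fin n)) :
    ∀ (d : ℕ) (a b : Fin n), (b : ℕ) = a + d + 1 → a ∉ S → b ∈ S →
      ∃ m : Fin n, ∃ hm : (m : ℕ) + 1 < n, m ∉ S ∧ (⟨(m : ℕ) + 1, hm⟩ : Fin n) ∈ S
  | 0, a, b, hd, ha, hb => by
    have hb' := b.is_lt
    have heq : b = ⟨(a : ℕ) + 1, by omega⟩ := Fin.ext (by rw [Fin.val_mk]; omega)
    rw [heq] at hb
    exact ⟨a, by omega, ha, hb⟩
  | d + 1, a, b, hd, ha, hb => by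
    have hb' := b.is_lt
    set a' : Fin n := ⟨(a : ℕ) + 1, by omega⟩ with ha'
    by_cases h : a' ∈ S
    · exact ⟨a, by omega, ha, h⟩
    · exact exists_adjacent_not_mem_mem S d a' b (by rw [ha']; simp; omega) h hb

/-- `#{k : Fin n | k < r} = r` for `r ≤ n`. [folklore] -/
theorem card_filter_lt_of_le {r : ℕ} (hr : r ≤ n) :
    (univ.filter fun k : Fin n => (k : ℕ) < r).card = r := by
  rw [Fin.card_filter_val_lt, min_eq_right hr]

/-- For `#S = r` and `S ≠ [0, r)`, the alternant `a_{ρ + 1_S}` vanishes: `S` misses some `a < r`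
and contains some `b ≥ r`, hence has an adjacent gap `m ∉ S ∋ m + 1`. [folklore] -/
theorem alternant_addOn_rho_eq_zero_of_ne {r : ℕ} (hr : r ≤ n) (x : Fin n → R)
    {S : Finset (Fin n)} (hS : S ∈ powersetCard r univ)
    (hne : S ≠ univ.filter fun k : Fin n => (k : ℕ) < r) :
    alternant x (addOn S (rho n)) = 0 := by
  have hcard : S.card = r := (mem_powersetCard.mp hS).2
  have h1 : ¬ S ⊆ univ.filter fun k : Fin n => (k : ℕ) < r := fun h =>
    hne (Finset.eq_of_subset_of_card_le h (by rw [card_filter_lt_of_le hr, hcard]))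
  have h2 : ¬ (univ.filter fun k : Fin n => (k : ℕ) < r) ⊆ S := fun h =>
    hne (Finset.eq_of_subset_of_card_le h (by rw [card_filter_lt_of_le hr, hcard])).symm
  rw [Finset.not_subset] at h1 h2
  obtain ⟨b, hbS, hb⟩ := h1
  obtain ⟨a, ha, haS⟩ := h2
  simp only [Finset.mem_filter, Finset.mem_univ, true_and, not_lt] at ha hb
  obtain ⟨m, hm, hm1, hm2⟩ :=
    exists_adjacent_not_mem_mem S ((b : ℕ) - a - 1) a b (by omega) haS hbS
  exact alternant_addOn_rho_eq_zero x hm hm1 hm2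

/-- **The dual Pieri sum on the staircase collapses**: `e_r(x) a_ρ(x) = a_{ρ + 1_{[0,r)}}(x)` for
`r ≤ n` — of the vertical `r`-strips added to `ρ` only the initial one gives distinct exponents.
[folklore] -/
theorem esymm_mul_alternant_rho (x : Fin n → R) {r : ℕ} (hr : r ≤ n) :
    esymm x r * alternant x (rho n) =
      alternant x (addOn (univ.filter fun k : Fin n => (k : ℕ) < r) (rho n)) := by
  rw [esymm_mul_alternant,
    Finset.sum_eq_single_of_mem (univ.filter fun k : Fin n => (k : ℕ) < r)]
  · exact mem_powersetCard.mpr ⟨Finset.filter_subset _ _, card_filter_lt_of_le hr⟩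
  · intro S hS hne
    exact alternant_addOn_rho_eq_zero_of_ne hr x hS hne

/-! ### `s_{(1^r)} = e_r` -/

/-- **The Schur polynomial of a column is the elementary symmetric polynomial**:
`s_{(1^r)}(x_1, …, x_n) = e_r(x_1, …, x_n)` for `r ≤ n` and `x` in any commutative ring, the
column weight being `(1^r) = 1_{[0,r)} = addOn {k < r} 0` (Macdonald 1995, Ch. I §3: `s_{(1^r)} =
e_r`, dual to `s_{(r)} = h_r`). From `esymm_mul_alternant_rho` and the bialternant formula,
`e_r a_ρ = s_{(1^r)} a_ρ`; cancel `a_ρ(X) ≠ 0` at the generic point `ℤ[X_1, …, X_n]` and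
specialise. [cite: Macdonald1995, Ch. I §3 (3.9)] -/
theorem schur_column_eq_esymm (x : Fin n → R) {r : ℕ} (hr : r ≤ n) :
    schur x (addOn (univ.filter fun k : Fin n => (k : ℕ) < r) 0) = esymm x r := by
  -- generic point
  have key : ∀ Y : Fin n → MvPolynomial (Fin n) ℤ, Function.Injective Y →
      schur Y (addOn (univ.filter fun k : Fin n => (k : ℕ) < r) 0) = esymm Y r := by
    intro Y hY
    have h := esymm_mul_alternant_rho Y hr
    rw [show addOn (univ.filter fun k : Fin n => (k : ℕ) < r) (rho n) =
        addOn (univ.filter fun k : Fin n => (k : ℕ) < r) 0 + rho n by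
      rw [← addOn_add, zero_add], alternant_add_rho] at h
    exact (mul_right_cancel₀ (alternant_rho_ne_zero hY) h).symm
  set f : MvPolynomial (Fin n) ℤ →+* R := MvPolynomial.eval₂Hom (Int.castRingHom R) x with hf
  have hx : (f ∘ MvPolynomial.X : Fin n → R) = x := funext fun i => by simp [hf]
  have h := congrArg f (key MvPolynomial.X MvPolynomial.X_injective)
  rwa [map_schur, map_esymm, hx] at h

/-- The column weight `(1^r)` is the indicator of `[0, r)`. [folklore] -/
theorem addOn_filter_lt_zero_apply (r : ℕ) (k : Fin n) :
    addOn (univ.filter fun k : Fin n => (k : ℕ) < r) 0 k = if (k : ℕ) < r then 1 else 0 := by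
  simp [addOn_apply]

/-- `s_{(1^r)} = e_r` with the column written as the indicator function `k ↦ [k < r]`. [folklore] -/
theorem schur_indicator_lt_eq_esymm (x : Fin n → R) {r : ℕ} (hr : r ≤ n) :
    schur x (fun k : Fin n => if (k : ℕ) < r then 1 else 0) = esymm x r := by
  rw [← schur_column_eq_esymm x hr]
  congr 1
  funext k
  rw [addOn_filter_lt_zero_apply]

/-- In particular `s_{(1^n)}(x) = e_n(x) = x_1 ⋯ x_n` (the determinant character). [folklore] -/
theorem schur_one_eq_prod (x : Fin n → R) : schur x 1 = ∏ i, x i := by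
  have h := schur_indicator_lt_eq_esymm x (le_refl n)
  have h1 : (fun k : Fin n => if (k : ℕ) < n then (1 : ℕ) else 0) = 1 := by
    funext k
    simp [k.is_lt]
  rw [h1] at h
  have hp : powersetCard n (univ : Finset (Fin n)) = {univ} := by
    convert Finset.powersetCard_self (univ : Finset (Fin n))
    simp
  rw [h, esymm, hp, Finset.sum_singleton]

end Literature.RingTheory.SymmetricFunctions.SymmPoly
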